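import Summits.QuantumFields.YangMills.Theorems.FluctuationComparisonRegPrIntLS1aOneStepLetterOfTransportBound
import HarnessLib

/-!
# S1a · THE ONE-STEP LETTER `(L_i)` FROM PER-PLAQUETTE CONDITIONAL TAILS: the plateau is missed only through ONE large plaquette or ONE goodness failure, so
# `(L_i)` ⟸ {per plaquette `p` of the height-`(i+1)` lattice: «given a good datum, `p` is off-plateau with conditional probability `≤ ε`»} + one goodness-failure tail,
# under the ENTROPY budget `#Plaq^{(i+1)}·ε + ε′ ≤ 1 − e^{−η_i}` — [Balaban1985UV3] (7)'s `χ = Π_p χ(p)` inserted at one level, by a union bound at MEASURE level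

Cell `ym3-torus` (YM ladder rung R3 = continuum `SU(2)` Yang–Mills on the three-torus — a RUNG: NOT d = 4, NOT infinite volume, NOT a mass gap, NOT Clay).
Width seat «width 8» `ym3-torus-px8` (gen 26), FREE px helper on crux `stmt-QuantumFields-20520`, count-neutral, DEFINITION-FREE, default heartbeats.  FILE 5 of the seat
(FILE 1 ✓p832521: `hdomBG_j` ⟸ set-form letters `(L_i)`; FILE 2 ✓p832934: `(L_i)` ⟸ a transport bound; FILE 3 ✓p833125: the fibre centre; FILE 4: the ᵀ-edition of the door).

WHY.  UV3-NODE §69.19 (4)(c): the residual transport letter «`T_i(ρ) ≤ e^{η_i}·T_i(1_{T_{i+1}}ρ)` on good data» is GLOBAL over the height-`(i+1)` torus, and a global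
per-configuration bound (the class's `large` clause with its volume factor `e^{c5|T|}`) cannot make `η_i` small: print's mechanism is LOCAL — the decomposition of unity
`χ_k = Π_p χ(|U(∂p) − 1| < ε_k)` ([Balaban1985UV3] (7) p.257) is inserted plaquette by plaquette and each large plaquette costs `e^{−c·p(g_k)²}` independently of its position.
THIS FILE types the first (union-bound) term of that expansion as a door at MEASURE level: the target `T_{i+1} = {∀ p, dist1(U(∂p)) ≤ θ′∕2} ∩ Good` is missed only if SOME
plaquette is off-plateau or the field is not good, so finitely many PER-PLAQUETTE CONDITIONAL TAILS plus one goodness-failure tail, each RELATIVE to the conditioning event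
`{Ū ∈ A}`, give `(L_i)` with `1 − e^{−η_i} ≥ #Plaq^{(i+1)}·ε + ε′` — the ENTROPY of §69.19 (4)(c) made explicit by kernel (`#Plaq^{(i+1)} = 3·|T^{(i+1)}|` sites in `d = 3`;
print's `ε ~ e^{−c·p(g_{i+1})²}` beats it since `p(g_i)² ~ (b₀ i log L)^{2p₀}`).

WHAT (0 `def`, 0 `sorry`; nothing of Bałaban's asserted — every tail is a HYPOTHESIS).
§0 `le_exp_mul_of_le_add_mul` — `a ≤ b + r·a`, `r ≤ 1 − e^{−η}` ⟹ `a ≤ e^{η}·b` in `ℝ≥0∞` [folklore].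
§1 ★★`le_exp_mul_inter_of_tails` — THE UNION BOUND for a finite measure: base `B`, measurable target `T`, `B ∖ T ⊆ (⋃_p Lg p) ∪ Bad`, relative tails `m(B ∩ Lg p) ≤ ε·m B`,
   `m(B ∩ Bad) ≤ ε′·m B`, `|ι|·ε + ε′ ≤ 1 − e^{−η}` ⟹ `m B ≤ e^{η}·m (B ∩ T)` [folklore].
§2 ★★★`oneStepLetter_of_plaquetteTails` — at the T³ runs: `ν'` a finite law at height `i+1`, good data `D` at height `i`, `Good` measurable; per-plaquette conditional tails
   `ν'(descend⁻¹A ∩ {θ′∕2 < dist1(U(∂p))}) ≤ ε·ν'(descend⁻¹A)` (all `p`, all measurable `A ⊆ D`) + `ν'(descend⁻¹A ∩ Goodᶜ) ≤ ε′·ν'(descend⁻¹A)` + the budget ⟹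
   `ν'(descend⁻¹A) ≤ e^{η}·ν'(descend⁻¹A ∩ ({∀ p, dist1 ≤ θ′∕2} ∩ Good))` — `(L_i)` of ✓p832521 with `T_{i+1} :=` plateau ∩ `Good`.
§3 ★★`setTail_of_transportTail` — the per-plaquette (or any-event) set-form tail from the a.e.-POINTWISE tail of the one-step renormalization transform read as a kernel:
   «`T(1_S·ρ)(V) ≤ ε·T(ρ)(V)` for `dU_i`-a.e. `V ∈ D`» ⟹ `ν'(descend⁻¹A ∩ S) ≤ ε·ν'(descend⁻¹A)` (lit ✓`T4AveragingDisintegration`, as in ✓p832934 §1).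

THE RESIDUAL AFTER THIS FILE (★p1; nothing asserted): per height `i` and per plaquette `p` of `T^{(i+1)}`, ONE conditional small-field tail «`T_i(1_{dist1(U(∂p)) > θ_{i+1}∕2}·ρ_{K−(i+1)})
≤ ε_{i+1}·T_i(ρ_{K−(i+1)})` a.e. on the good data» with `3|T^{(i+1)}|·ε_{i+1} ≤ (1 − e^{−η_i})∕2`, say, and the goodness-failure tail — print's per-plaquette `e^{−c·p(g)²}` (its inputs:
UV3-NODE §69.19 (4)(a)(b)(d)).  HONEST: measure-theoretic bookkeeping; nothing of Bałaban's renormalisation-group analysis asserted or proved; `(L_i)` ∕ transport letters ∕ `hdomBG_j`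
NOT discharged; (m) AS TYPED suspect-false at `L = 3` (RULING №105), (m)_E OPEN; (α) UNINHABITED; the five registered stubs (3732b7df) ∕ 20520 ∕ 19936 ∕ 19200 ∕ `YM3TorusSU2` NOT
proved; rung R3 = SU(2) YM₃ on T³ — NOT d = 4, NOT infinite volume, NOT a mass gap, NOT Clay.
References: [Balaban1985UV3] CMP 102 (1985) (7) p.257, (47) p.267; [Balaban1987RG1] CMP 109 (1987) (0.13) p.254.
-/

set_option autoImplicit false

noncomputable section

namespace Summit.QuantumFields.YangMills.Theorems.FluctuationComparisonRegPrIntLS1aOneStepLetterOfPlaquetteTails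

open MeasureTheory Filter Topology Set Function
open scoped ENNReal NNReal
open Literature.MathematicalPhysics.QuantumFieldTheory.Balaban1983to89
open T3ContinuumYM3Torus T3NestedUnitLaws T3UnitLawDensityEML T3LevelShift
open Literature.MathematicalPhysics.QuantumFieldTheory.Balaban1983to89.T4AveragingDisintegration (kernelTransport integral_kernelTransport_mul
  integrable_kernelTransport)
open Summit.QuantumFields.YangMills.Theorems.OrganTangentFibreMeanTools (absolutelyContinuous_map_descend)
open Summit.QuantumFields.YangMills.Theorems.FluctuationComparisonRegPrIntLS1aOneStepLetterOfTransportBound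
  (withDensity_apply_eq_ofReal_integral_mul_indicator)

/-! ## §0 Extended-real bookkeeping: absorbing a relative loss `r ≤ 1 − e^{−η}` -/

section Absorb

/-- If `a ≤ b + r·a` with `a < ∞`, `0 ≤ r` and `r ≤ 1 − e^{−η}`, then `a ≤ e^{η}·b` (in `ℝ≥0∞`, `r` real). [folklore] -/
theorem le_exp_mul_of_le_add_mul {a b : ℝ≥0∞} (ha : a ≠ ∞) (hb : b ≠ ∞) {r η : ℝ} (hr0 : 0 ≤ r) (hr : r ≤ 1 - Real.exp (-η))
    (h : a ≤ b + ENNReal.ofReal r * a) : a ≤ ENNReal.ofReal (Real.exp η) * b := by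
  have hexp : 0 < Real.exp (-η) := Real.exp_pos _
  -- pass to reals
  have h' : a.toReal ≤ b.toReal + r * a.toReal := by
    have := (ENNReal.toReal_le_toReal ha (by simp [hb, ha, ENNReal.mul_eq_top])).mpr h
    rwa [ENNReal.toReal_add hb (by simp [ha, ENNReal.mul_eq_top]), ENNReal.toReal_mul, ENNReal.toReal_ofReal hr0] at this
  have h1 : Real.exp (-η) * a.toReal ≤ b.toReal := by nlinarith [ENNReal.toReal_nonneg (a := a)]
  have h2 : a.toReal ≤ Real.exp η * b.toReal := by
    have := mul_le_mul_of_nonneg_left h1 (Real.exp_pos η).le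
    rwa [← mul_assoc, ← Real.exp_add, add_neg_cancel, Real.exp_zero, one_mul] at this
  calc a = ENNReal.ofReal a.toReal := (ENNReal.ofReal_toReal ha).symm
    _ ≤ ENNReal.ofReal (Real.exp η * b.toReal) := ENNReal.ofReal_le_ofReal h2
    _ = ENNReal.ofReal (Real.exp η) * b := by rw [ENNReal.ofReal_mul (Real.exp_nonneg _), ENNReal.ofReal_toReal hb]

end Absorb

/-! ## §1 The abstract union bound: a target missed only through finitely many «large» events or one «bad» event -/

section Union

variable {β : Type*} [MeasurableSpace β]

/-- ★★ **THE UNION BOUND.**  A finite measure `m`, a base event `B`, a measurable target `T`, finitely many «large» events `Lg p` (`p ∈ ι`, a `Fintype`) and one «bad» event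
with `B ∖ T ⊆ (⋃ p, Lg p) ∪ Bad`; per-event RELATIVE tails `m (B ∩ Lg p) ≤ ε·m B`, `m (B ∩ Bad) ≤ ε′·m B` with `|ι|·ε + ε′ ≤ 1 − e^{−η}` (`ε, ε′ ≥ 0`) ⟹
`m B ≤ e^{η}·m (B ∩ T)`. [folklore] -/
theorem le_exp_mul_inter_of_tails {ι : Type*} [Fintype ι] (m : Measure β) [IsFiniteMeasure m]
    {B T Bad : Set β} (hT : MeasurableSet T) (Lg : ι → Set β) (hcover : B \ T ⊆ (⋃ p, Lg p) ∪ Bad)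
    {ε ε' η : ℝ} (hε : 0 ≤ ε) (hε' : 0 ≤ ε') (hsum : (Fintype.card ι : ℝ) * ε + ε' ≤ 1 - Real.exp (-η))
    (htail : ∀ p, m (B ∩ Lg p) ≤ ENNReal.ofReal ε * m B) (hbad : m (B ∩ Bad) ≤ ENNReal.ofReal ε' * m B) :
    m B ≤ ENNReal.ofReal (Real.exp η) * m (B ∩ T) := by
  -- split `B` along `T`
  have hsplit : m B ≤ m (B ∩ T) + m (B \ T) := by
    rw [← measure_inter_add_sdiff B hT]
  -- the complement part is covered by the large events and the bad event
  have hdiff : m (B \ T) ≤ (∑ p, m (B ∩ Lg p)) + m (B ∩ Bad) := by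
    have hsub : B \ T ⊆ (⋃ p, B ∩ Lg p) ∪ (B ∩ Bad) := by
      intro U hU
      rcases hcover hU with h | h
      · obtain ⟨p, hp⟩ := mem_iUnion.mp h
        exact Or.inl (mem_iUnion.mpr ⟨p, hU.1, hp⟩)
      · exact Or.inr ⟨hU.1, h⟩
    refine (measure_mono hsub).trans ((measure_union_le _ _).trans ?_)
    gcongr
    exact (measure_iUnion_fintype_le m fun p => B ∩ Lg p)
  have hsumle : (∑ p, m (B ∩ Lg p)) + m (B ∩ Bad) ≤ ENNReal.ofReal ((Fintype.card ι : ℝ) * ε + ε') * m B := by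
    calc (∑ p, m (B ∩ Lg p)) + m (B ∩ Bad)
        ≤ (∑ _p : ι, ENNReal.ofReal ε * m B) + ENNReal.ofReal ε' * m B := add_le_add (Finset.sum_le_sum fun p _ => htail p) hbad
      _ = ENNReal.ofReal ((Fintype.card ι : ℝ) * ε + ε') * m B := by
          rw [Finset.sum_const, Finset.card_univ, nsmul_eq_mul, ENNReal.ofReal_add (mul_nonneg (Nat.cast_nonneg _) hε) hε',
            ENNReal.ofReal_mul (Nat.cast_nonneg _), ENNReal.ofReal_natCast]
          ring
  refine le_exp_mul_of_le_add_mul (measure_ne_top m B) (measure_ne_top m _) (by positivity) hsum ?_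
  exact hsplit.trans (add_le_add le_rfl (hdiff.trans hsumle))

end Union

/-! ## §2 The one-step letter `(L_i)` from PER-PLAQUETTE conditional tails and one goodness-failure tail -/

section Letter

variable (F : T3Family)

/-- ★★★ **THE ONE-STEP CONDITIONAL PLATEAU LETTER FROM PER-PLAQUETTE CONDITIONAL TAILS.**  Run law `ν'` at height `i+1` (a finite measure), good data `D` at height `i`,
the target `T' := {U | ∀ p, dist1 (U(∂p)) ≤ θ′∕2} ∩ Good` (plateau of the cut `sfCut θ′` ∩ the supplier's good set, `Good` measurable).  IF for every plaquette `p` of the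
height-`(i+1)` lattice and every measurable `A ⊆ D`: `ν' (descend⁻¹A ∩ {θ′∕2 < dist1 (U(∂p))}) ≤ ε·ν' (descend⁻¹A)` («given the average is a good datum, plaquette `p` is
off-plateau with conditional probability `≤ ε`» — [Balaban1985UV3] (7) p.257's `χ = Π_p χ_p` inserted at ONE level, the per-plaquette small-field tail), and
`ν' (descend⁻¹A ∩ Goodᶜ) ≤ ε′·ν' (descend⁻¹A)`, with the ENTROPY budget `#Plaq·ε + ε′ ≤ 1 − e^{−η}`, THEN `(L_i)`: `ν' (descend⁻¹A) ≤ e^{η}·ν' (descend⁻¹A ∩ T')`.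
Nothing of Bałaban's asserted; the tails are HYPOTHESES. [cite: Balaban1985UV3, (7) p.257 and (47) p.267] -/
theorem oneStepLetter_of_plaquetteTails (i : ℕ)
    (ν' : Measure (GaugeField (F.P (i + 1)) 0 ↥(Matrix.specialUnitaryGroup (Fin 2) ℂ))) [IsFiniteMeasure ν']
    (D : Set (GaugeField (F.P i) 0 ↥(Matrix.specialUnitaryGroup (Fin 2) ℂ)))
    {Good : Set (GaugeField (F.P (i + 1)) 0 ↥(Matrix.specialUnitaryGroup (Fin 2) ℂ))} (hGood : MeasurableSet Good) {θ' ε ε' η : ℝ}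
    (hε : 0 ≤ ε) (hε' : 0 ≤ ε')
    (hsum : (Fintype.card (Plaq (F.P (i + 1)) 0) : ℝ) * ε + ε' ≤ 1 - Real.exp (-η))
    (htail : ∀ (p : Plaq (F.P (i + 1)) 0) (A : Set (GaugeField (F.P i) 0 ↥(Matrix.specialUnitaryGroup (Fin 2) ℂ))), MeasurableSet A → A ⊆ D →
      ν' (descend F ℰp i ⁻¹' A ∩ {U | θ' / 2 < dist1 (GaugeField.plaqHol U p)}) ≤ ENNReal.ofReal ε * ν' (descend F ℰp i ⁻¹' A))
    (hbad : ∀ (A : Set (GaugeField (F.P i) 0 ↥(Matrix.specialUnitaryGroup (Fin 2) ℂ))), MeasurableSet A → A ⊆ D →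
      ν' (descend F ℰp i ⁻¹' A ∩ Goodᶜ) ≤ ENNReal.ofReal ε' * ν' (descend F ℰp i ⁻¹' A))
    {A : Set (GaugeField (F.P i) 0 ↥(Matrix.specialUnitaryGroup (Fin 2) ℂ))} (hA : MeasurableSet A) (hAD : A ⊆ D) :
    ν' (descend F ℰp i ⁻¹' A) ≤ ENNReal.ofReal (Real.exp η) *
      ν' (descend F ℰp i ⁻¹' A ∩ ({U | ∀ p, dist1 (GaugeField.plaqHol U p) ≤ θ' / 2} ∩ Good)) := by
  have hplat : MeasurableSet {U : GaugeField (F.P (i + 1)) 0 ↥(Matrix.specialUnitaryGroup (Fin 2) ℂ) | ∀ p, dist1 (GaugeField.plaqHol U p) ≤ θ' / 2} := by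
    rw [Set.setOf_forall]
    exact MeasurableSet.iInter fun p =>
      measurableSet_le (RegularGaugeGroup.measurable_dist1.comp (Missing.measurable_plaqHol p)) measurable_const
  refine le_exp_mul_inter_of_tails ν' (hplat.inter hGood) (fun p => {U | θ' / 2 < dist1 (GaugeField.plaqHol U p)}) ?_ hε hε' hsum
    (fun p => htail p A hA hAD) (hbad A hA hAD)
  -- cover: off the target means off the plateau at some plaquette, or not good
  intro U hU
  have hnot : ¬ (U ∈ {U | ∀ p, dist1 (GaugeField.plaqHol U p) ≤ θ' / 2} ∧ U ∈ Good) := hU.2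
  by_cases hg : U ∈ Good
  · have hnp : ¬ ∀ p, dist1 (GaugeField.plaqHol U p) ≤ θ' / 2 := fun h => hnot ⟨h, hg⟩
    obtain ⟨p, hp⟩ := not_forall.mp hnp
    exact Or.inl (mem_iUnion.mpr ⟨p, not_le.mp hp⟩)
  · exact Or.inr hg

end Letter

/-! ## §3 A per-plaquette conditional tail from a POINTWISE tail bound on the one-step renormalization transform -/

section Transport

variable (F : T3Family)

/-- ★★ **SET-FORM TAIL FROM A TRANSPORT TAIL** (companion of ✓`…S1aOneStepLetterOfTransportBound.oneStepLetter_of_transportBound`): for a law `ν'` with integrable density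
`ρ ≥ 0` w.r.t. `dU_{i+1}` and a measurable event `S`, the a.e.-pointwise bound «`T(1_S·ρ)(V) ≤ ε·T(ρ)(V)` for `dU_i`-a.e. `V ∈ D`» on the one-step kernel transport along
`descend F ℰp i` gives `ν' (descend⁻¹A ∩ S) ≤ ε·ν' (descend⁻¹A)` for every measurable `A ⊆ D` (`ε ≥ 0`). [cite: Balaban1987RG1, (0.13) p.254; Balaban1985UV3, (7) p.257] -/
theorem setTail_of_transportTail (i : ℕ)
    {ν' : Measure (GaugeField (F.P (i + 1)) 0 ↥(Matrix.specialUnitaryGroup (Fin 2) ℂ))}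
    {ρ : GaugeField (F.P (i + 1)) 0 ↥(Matrix.specialUnitaryGroup (Fin 2) ℂ) → ℝ}
    (hρi : Integrable ρ (fieldMeasure (F.P (i + 1)) 0 ↥(Matrix.specialUnitaryGroup (Fin 2) ℂ))) (hρ0 : ∀ U, 0 ≤ ρ U)
    (hν : ν' = (fieldMeasure (F.P (i + 1)) 0 ↥(Matrix.specialUnitaryGroup (Fin 2) ℂ)).withDensity fun U => ENNReal.ofReal (ρ U))
    (D : Set (GaugeField (F.P i) 0 ↥(Matrix.specialUnitaryGroup (Fin 2) ℂ)))
    {S : Set (GaugeField (F.P (i + 1)) 0 ↥(Matrix.specialUnitaryGroup (Fin 2) ℂ))} (hS : MeasurableSet S) {ε : ℝ} (hε : 0 ≤ ε)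
    (hKT : ∀ᵐ V ∂(fieldMeasure (F.P i) 0 ↥(Matrix.specialUnitaryGroup (Fin 2) ℂ)), V ∈ D →
      kernelTransport (fieldMeasure (F.P (i + 1)) 0 ↥(Matrix.specialUnitaryGroup (Fin 2) ℂ)) (fieldMeasure (F.P i) 0 ↥(Matrix.specialUnitaryGroup (Fin 2) ℂ))
          (descend F ℰp i) (S.indicator ρ) V ≤
        ε * kernelTransport (fieldMeasure (F.P (i + 1)) 0 ↥(Matrix.specialUnitaryGroup (Fin 2) ℂ))
          (fieldMeasure (F.P i) 0 ↥(Matrix.specialUnitaryGroup (Fin 2) ℂ)) (descend F ℰp i) ρ V)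
    {A : Set (GaugeField (F.P i) 0 ↥(Matrix.specialUnitaryGroup (Fin 2) ℂ))} (hA : MeasurableSet A) (hAD : A ⊆ D) :
    ν' (descend F ℰp i ⁻¹' A ∩ S) ≤ ENNReal.ofReal ε * ν' (descend F ℰp i ⁻¹' A) := by
  set dU := fieldMeasure (F.P (i + 1)) 0 ↥(Matrix.specialUnitaryGroup (Fin 2) ℂ) with hdU
  set dV := fieldMeasure (F.P i) 0 ↥(Matrix.specialUnitaryGroup (Fin 2) ℂ) with hdV
  haveI : IsProbabilityMeasure dU := Missing.isProbabilityMeasure_fieldMeasure _ _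
  haveI : IsProbabilityMeasure dV := Missing.isProbabilityMeasure_fieldMeasure _ _
  have hd : Measurable (descend F ℰp i : GaugeField (F.P (i + 1)) 0 ↥(Matrix.specialUnitaryGroup (Fin 2) ℂ) →
      GaugeField (F.P i) 0 ↥(Matrix.specialUnitaryGroup (Fin 2) ℂ)) := measurable_descend F ℰp measurableE_ℰp i
  have hac : dU.map (descend F ℰp i) ≪ dV := absolutelyContinuous_map_descend F i
  have hρSi : Integrable (S.indicator ρ) dU := hρi.indicator hS
  have hf : Measurable (A.indicator fun _ => (1 : ℝ)) := measurable_const.indicator hA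
  have hfC : ∀ V, |A.indicator (fun _ => (1 : ℝ)) V| ≤ 1 := fun V => by
    by_cases hV : V ∈ A
    · simp [hV]
    · simp [hV]
  have e1 : ν' (descend F ℰp i ⁻¹' A) = ENNReal.ofReal (∫ U, ρ U * A.indicator (fun _ => (1 : ℝ)) (descend F ℰp i U) ∂dU) := by
    rw [hν, withDensity_apply_eq_ofReal_integral_mul_indicator hρi hρ0 (hA.preimage hd)]
    rfl
  have e2 : ν' (descend F ℰp i ⁻¹' A ∩ S) = ENNReal.ofReal (∫ U, S.indicator ρ U * A.indicator (fun _ => (1 : ℝ)) (descend F ℰp i U) ∂dU) := by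
    rw [hν, withDensity_apply_eq_ofReal_integral_mul_indicator hρi hρ0 ((hA.preimage hd).inter hS)]
    congr 1
    refine integral_congr_ae (ae_of_all _ fun U => ?_)
    by_cases h1 : U ∈ S
    · by_cases h2 : descend F ℰp i U ∈ A
      · simp [h1, h2]
      · simp [h1, h2]
    · by_cases h2 : descend F ℰp i U ∈ A
      · simp [h1, h2]
      · simp [h1, h2]
  rw [e1, e2, integral_kernelTransport_mul dU dV hd hac hρi hf hfC |>.symm,
    integral_kernelTransport_mul dU dV hd hac hρSi hf hfC |>.symm, ← ENNReal.ofReal_mul hε, ← integral_const_mul]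
  refine ENNReal.ofReal_le_ofReal (integral_mono_ae ?_ ?_ ?_)
  · exact (integrable_kernelTransport dU dV hd hac hρSi).mul_bdd hf.aestronglyMeasurable
      (Filter.Eventually.of_forall fun V => by simpa [Real.norm_eq_abs] using hfC V)
  · exact ((integrable_kernelTransport dU dV hd hac hρi).mul_bdd hf.aestronglyMeasurable
      (Filter.Eventually.of_forall fun V => by simpa [Real.norm_eq_abs] using hfC V)).const_mul _
  · filter_upwards [hKT] with V hV
    by_cases hVA : V ∈ A
    · have h := hV (hAD hVA)
      simp only [hVA, indicator_of_mem, mul_one]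
      exact h
    · simp [hVA]

end Transport

end Summit.QuantumFields.YangMills.Theorems.FluctuationComparisonRegPrIntLS1aOneStepLetterOfPlaquetteTails

end
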